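import Summits.Ventures.PercRepro.Night2LocalThmEFinal
import Summits.Ventures.PercRepro.Night2LocalAllLayerZero
import Summits.Ventures.PercRepro.Night2LocalCovering

/-!
# PercRepro — the regime `|E ∖ G| = q` at `q = 4` for SIMPLE matroids, core (night-2, gen 11)

Theorem E (`localShadowHall_dq`, gen 8) proves the local form (LI_G) at a rank-`(q+1)` flat `G` with
`|E ∖ G| = q` whenever the coloop count `k` of `M|G` satisfies `2k ≤ (q+1−k)²`; `k ≥ q` is
`localShadowHall_of_kColoops`.  At `q = 4` this leaves exactly `k = 3`.  Here the distance-2 rule is checked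
directly at `k = 3` for a LOOPLESS SIMPLE matroid (any two distinct elements span rank `2`):

* `eRk_eq_card_coloops_add`: the coloops of a set add rank: `ρ(S) = #coloops(S) + ρ(S ∖ coloops(S))`;
* `ex2_eq_empty_of_card_coloops_eq_four`: with `4` coloops the non-coloops have rank `1` — a series pair would
  be a parallel pair; no layer-2 weight at all;
* `card_ex2_m_two_le_one`: with `3` coloops and a layer-0 covering preimage, at most one member carrying layer-2
  weight has `|G ∖ cl B| = 2` (two of them force `G = S`, and then the layer-0 preimage `G ∖ y` has a complement
  of rank `≤ 5`);
The assembly (`w2_le_dq_div`, `load2_le_cap2_of_three`, `localShadowHall_dq_four_three`,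
`localShadowHall_dq_four_of_simple`) is `Night2LocalDQFour.lean`.
-/

open scoped Matroid

namespace PercRepro.Shadow

open Finset PerFlat ThmH

variable {α : Type*} [DecidableEq α] {M : Matroid α} [M.Finite]

section Coloops

/-- The coloops of `S` lie in `S`. -/
theorem coloops_subset_self (S : Finset α) : coloops M S ⊆ S := fun _ h => (mem_coloops.1 h).1

/-- **Coloops add rank**: `ρ(S) = #coloops(S) + ρ(S ∖ coloops(S))`. -/
theorem eRk_eq_card_coloops_add {S : Finset α} (hS : S ⊆ gr M) :
    M.eRk (S : Set α) = ((coloops M S).card : ℕ∞) + M.eRk ((nonColoops M S : Finset α) : Set α) := by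
  have h := eRk_union_coloops hS (coloops M S) (fun y hy => mem_coloops.1 hy)
    (X := nonColoops M S) Finset.sdiff_subset Finset.disjoint_sdiff
  unfold nonColoops at h ⊢
  rwa [Finset.union_sdiff_of_subset (coloops_subset_self S)] at h

/-- In a simple matroid a set of rank `≤ 1` has at most one element. -/
theorem card_le_one_of_eRk_le_one (hs : ∀ e ∈ gr M, ∀ f ∈ gr M, e ≠ f → rkN M {e, f} = 2)
    {X : Finset α} (hX : X ⊆ gr M) (hr : M.eRk (X : Set α) ≤ 1) : X.card ≤ 1 := by
  by_contra hlt
  push Not at hlt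
  obtain ⟨x, hx, y, hy, hxy⟩ := Finset.one_lt_card.1 hlt
  have hpair : ({x, y} : Finset α) ⊆ X := by
    intro e he
    rw [Finset.mem_insert, Finset.mem_singleton] at he
    rcases he with rfl | rfl
    · exact hx
    · exact hy
  have h2 : M.eRk (({x, y} : Finset α) : Set α) ≤ 1 :=
    (M.eRk_mono (by exact_mod_cast hpair)).trans hr
  rw [eRk_eq_rkN, hs x (hX hx) y (hX hy) hxy] at h2
  exact absurd h2 (by norm_num)

end Coloops

section Ex2

variable {q : ℕ} {G S : Finset α}

/-- Membership in `ex2`, unpacked: the member and the condition of `w2`. -/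
theorem mem_ex2_unpack {B : Finset α} (hB : B ∈ ex2 M q G S) :
    B ∈ membersIn M (Uq M (q + 2) q) G ∧ B ∉ lay0 M q G ∧ B ⊆ S ∧ S \ B ⊆ G \ clF M B ∧
      (S \ B).card = 2 := by
  unfold ex2 at hB
  rw [Finset.mem_filter] at hB
  obtain ⟨hBm, hw⟩ := hB
  refine ⟨hBm, ?_⟩
  by_contra hcond
  apply hw
  unfold w2
  rw [if_neg]
  exact hcond

/-- A member of `ex2` with `|G ∖ cl B| = 2` has `S ∖ B = G ∖ cl B`. -/
theorem sdiff_eq_of_mem_ex2 {B : Finset α} (hB : B ∈ ex2 M q G S) (hm : (G \ clF M B).card = 2) :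
    S \ B = G \ clF M B := by
  obtain ⟨-, -, -, hsub, hcard⟩ := mem_ex2_unpack hB
  exact Finset.eq_of_subset_of_card_le hsub (by omega)

/-- The rank of a shadow set with closure `G ∈ flatsQ M (q + 1)`. -/
theorem rkN_eq_of_mem_shadowAt (hS : S ∈ shadowAt M (q + 2) q (Uq M (q + 2) q) G) : rkN M S = q + 1 := by
  unfold rkN
  rw [eRk_eq_of_mem_Yq_diag (mem_shadow.1 (mem_shadowAt.1 hS).1).1]
  rfl

open scoped Classical in
/-- The two elements of a series pair. -/
theorem exists_pair_of_mem_seriesPairs {P : Finset α} {u : ℕ} (hP : P ∈ seriesPairs M S u) :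
    ∃ x y, x ≠ y ∧ P = {x, y} ∧ SeriesPair M S u x y := by
  unfold seriesPairs at hP
  rw [Finset.mem_filter, Finset.mem_powersetCard] at hP
  obtain ⟨⟨-, hcard⟩, hser⟩ := hP
  obtain ⟨x, y, hxy, rfl⟩ := Finset.card_eq_two.1 hcard
  exact ⟨x, y, hxy, rfl, hser x (by simp) y (by simp) hxy⟩

/-- A series pair lies in the non-coloops. -/
theorem subset_nonColoops_of_mem_seriesPairs (hS : S ⊆ gr M) {u : ℕ} (hSr : rkN M S = u + 1)
    {P : Finset α} (hP : P ∈ seriesPairs M S u) : P ⊆ nonColoops M S := by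
  obtain ⟨x, y, -, rfl, hser⟩ := exists_pair_of_mem_seriesPairs hP
  intro e he
  rw [Finset.mem_insert, Finset.mem_singleton] at he
  rcases he with rfl | rfl
  · exact mem_nonColoops_of_seriesPair hS hSr hser
  · exact mem_nonColoops_of_seriesPair hS hSr hser.symm

/-- The rank of the non-coloops, from the rank of `S` and the coloop count. -/
theorem rkN_nonColoops_add (hS : S ⊆ gr M) :
    rkN M (nonColoops M S) + (coloops M S).card = rkN M S := by
  have h := eRk_eq_card_coloops_add hS
  rw [eRk_eq_rkN, eRk_eq_rkN] at h
  have h' : rkN M S = (coloops M S).card + rkN M (nonColoops M S) := by exact_mod_cast h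
  omega

/-- **With four coloops at `q = 4` there is no layer-2 weight**: the non-coloops have rank `1`, so a series pair
would be a parallel pair. -/
theorem ex2_eq_empty_of_card_coloops_eq_four (hs : ∀ e ∈ gr M, ∀ f ∈ gr M, e ≠ f → rkN M {e, f} = 2)
    (hG : G ∈ flatsQ M (4 + 1)) (hS : S ∈ shadowAt M (4 + 2) 4 (Uq M (4 + 2) 4) G)
    (ha : (coloops M S).card = 4) : ex2 M 4 G S = ∅ := by
  rw [Finset.eq_empty_iff_forall_notMem]
  intro B hB
  have hSG : S ⊆ G := subset_of_mem_shadowAt hS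
  have hSE : S ⊆ gr M := hSG.trans (mem_flatsQ.1 hG).1
  have hSr : rkN M S = 4 + 1 := rkN_eq_of_mem_shadowAt hS
  have hP := sdiff_mem_seriesPairs hG hS hB
  have hPT := subset_nonColoops_of_mem_seriesPairs hSE hSr hP
  have hcardP : (S \ B).card = 2 := (mem_ex2_unpack hB).2.2.2.2
  have h1 : rkN M (nonColoops M S) = 1 := by
    have := rkN_nonColoops_add hSE
    omega
  have h2 : (nonColoops M S).card ≤ 1 := by
    apply card_le_one_of_eRk_le_one hs (X := nonColoops M S)
      (by unfold nonColoops; exact Finset.sdiff_subset.trans hSE)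
    rw [eRk_eq_rkN, h1]
    exact le_rfl
  have := Finset.card_le_card hPT
  omega

end Ex2

section Three

variable {G S : Finset α}

open scoped Classical in
/-- The coloops of `M|G` are coloops of every shadow set `S` with closure `G`. -/
theorem coloopsG_subset_coloops {q : ℕ} (hS : S ∈ shadowAt M (q + 2) q (Uq M (q + 2) q) G) :
    G.filter (fun y => y ∉ clF M (G.erase y)) ⊆ coloops M S := by
  have hSG : S ⊆ G := subset_of_mem_shadowAt hS
  have hcl : clF M S = G := (mem_shadowAt.1 hS).2
  intro y hy
  rw [Finset.mem_filter] at hy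
  have hyS : y ∈ S := by
    by_contra hyS
    have hsub : S ⊆ G.erase y := fun e he => Finset.mem_erase.2 ⟨fun h => hyS (h ▸ he), hSG he⟩
    have := clF_mono (M := M) hsub
    rw [hcl] at this
    exact hy.2 (this hy.1)
  rw [mem_coloops]
  exact ⟨hyS, fun h => hy.2 (clF_mono (Finset.erase_subset_erase y hSG) h)⟩

open scoped Classical in
/-- If `#coloops(S) = kColoops G`, the coloops of `S` are exactly the coloops of `M|G`. -/
theorem coloops_eq_filter_of_card {q : ℕ} (hS : S ∈ shadowAt M (q + 2) q (Uq M (q + 2) q) G)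
    (ha : (coloops M S).card = kColoops M G) :
    coloops M S = G.filter (fun y => y ∉ clF M (G.erase y)) := by
  symm
  apply Finset.eq_of_subset_of_card_le (coloopsG_subset_coloops hS)
  unfold kColoops at ha
  omega

/-- A set `X ⊆ cl B` with `B ∈ Uq M (q + 2) q` has rank `≤ q`. -/
theorem rkN_le_of_subset_clF {q : ℕ} {B X : Finset α} (hB : B ∈ Uq M (q + 2) q) (hX : X ⊆ clF M B) :
    rkN M X ≤ q := by
  have hBq : M.eRk (B : Set α) = (q : ℕ∞) := (mem_Uq.1 hB).2.1
  have h1 : M.eRk (X : Set α) ≤ M.eRk ((clF M B : Finset α) : Set α) := M.eRk_mono (by exact_mod_cast hX)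
  rw [coe_clF, M.eRk_closure_eq, hBq, eRk_eq_rkN] at h1
  exact_mod_cast h1

/-- **Two members of `ex2` with `|G ∖ cl B| = 2` are impossible at a shadow set with a layer-0 covering
preimage** (`q = 4`, `k = 3 = #coloops(S)`, loopless simple `M`): two such members force `G = S`, and then the
layer-0 preimage `G ∖ y` has a complement `(E ∖ G) ∪ {y}` of rank `≤ 5 < 6`. -/
theorem not_two_ex2_of_card_two (hs : ∀ e ∈ gr M, ∀ f ∈ gr M, e ≠ f → rkN M {e, f} = 2)
    (hl : ∀ e ∈ gr M, M.Indep {e}) (hG : G ∈ flatsQ M (4 + 1)) (hd : (gr M \ G).card = 4)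
    (hk : kColoops M G = 3) (hS : S ∈ shadowAt M (4 + 2) 4 (Uq M (4 + 2) 4) G)
    (ha : (coloops M S).card = 3) (hk1 : 1 ≤ k1 M 4 G S) {B₁ B₂ : Finset α}
    (h1 : B₁ ∈ ex2 M 4 G S) (h2 : B₂ ∈ ex2 M 4 G S) (hne : B₁ ≠ B₂)
    (hm1 : (G \ clF M B₁).card = 2) (hm2 : (G \ clF M B₂).card = 2) : False := by
  classical
  have hSG : S ⊆ G := subset_of_mem_shadowAt hS
  have hGE : G ⊆ gr M := (mem_flatsQ.1 hG).1
  have hSE : S ⊆ gr M := hSG.trans hGE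
  have hSr : rkN M S = 4 + 1 := rkN_eq_of_mem_shadowAt hS
  obtain ⟨hB1m, -, hB1S, -, hc1⟩ := mem_ex2_unpack h1
  obtain ⟨hB2m, -, hB2S, -, hc2⟩ := mem_ex2_unpack h2
  have hB1U : B₁ ∈ Uq M (4 + 2) 4 := (mem_membersIn.1 hB1m).1
  have hB2U : B₂ ∈ Uq M (4 + 2) 4 := (mem_membersIn.1 hB2m).1
  -- the series pairs P₁, P₂ ⊆ T := nonColoops S
  set P₁ := S \ B₁ with hP₁
  set P₂ := S \ B₂ with hP₂
  have hP1s := sdiff_mem_seriesPairs hG hS h1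
  have hP2s := sdiff_mem_seriesPairs hG hS h2
  have hP1T : P₁ ⊆ nonColoops M S := subset_nonColoops_of_mem_seriesPairs hSE hSr hP1s
  have hP2T : P₂ ⊆ nonColoops M S := subset_nonColoops_of_mem_seriesPairs hSE hSr hP2s
  have hB1eq : B₁ = S \ P₁ := (Finset.sdiff_sdiff_eq_self hB1S).symm
  have hB2eq : B₂ = S \ P₂ := (Finset.sdiff_sdiff_eq_self hB2S).symm
  have hPne : P₁ ≠ P₂ := fun h => hne (by rw [hB1eq, hB2eq, h])
  -- |T| ≤ 3 : ρ(T ∖ P₁) = 1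
  obtain ⟨x, y, hxy, hPxy, hser⟩ := exists_pair_of_mem_seriesPairs hP1s
  rw [← hP₁] at hPxy
  have hT1 : rkN M (nonColoops M S \ P₁) = 1 := by
    have hunion : coloops M S ∪ (nonColoops M S \ P₁) = S \ P₁ := by
      ext e
      simp only [Finset.mem_union, Finset.mem_sdiff, nonColoops]
      constructor
      · rintro (he | ⟨⟨heS, -⟩, heP⟩)
        · exact ⟨coloops_subset_self S he, fun heP => (Finset.mem_sdiff.1 (hP1T heP)).2 he⟩
        · exact ⟨heS, heP⟩
      · rintro ⟨heS, heP⟩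
        by_cases hc : e ∈ coloops M S
        · exact Or.inl hc
        · exact Or.inr ⟨⟨heS, hc⟩, heP⟩
    have h := eRk_union_coloops hSE (coloops M S) (fun y hy => mem_coloops.1 hy)
      (X := nonColoops M S \ P₁) (Finset.sdiff_subset.trans Finset.sdiff_subset)
      (Finset.disjoint_of_subset_right Finset.sdiff_subset Finset.disjoint_sdiff)
    rw [hunion, ha, eRk_eq_rkN, eRk_eq_rkN] at h
    have hr4 : rkN M (S \ P₁) = 4 := by rw [hPxy]; exact hser.2.2.2.2.2
    rw [hr4] at h
    have h' : (4 : ℕ) = 3 + rkN M (nonColoops M S \ P₁) := by exact_mod_cast h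
    omega
  have hT3 : (nonColoops M S).card ≤ 3 := by
    have hle : (nonColoops M S \ P₁).card ≤ 1 := by
      apply card_le_one_of_eRk_le_one hs (X := nonColoops M S \ P₁)
        (Finset.sdiff_subset.trans (Finset.sdiff_subset.trans hSE))
      rw [eRk_eq_rkN, hT1]
      exact le_rfl
    have := Finset.card_sdiff_add_card_eq_card hP1T
    omega
  -- P₁ ∩ P₂ = {w}, P₁ ∪ P₂ = T
  have hcU : (P₁ ∪ P₂).card ≤ 3 := (Finset.card_le_card (Finset.union_subset hP1T hP2T)).trans hT3
  have hUI := Finset.card_union_add_card_inter P₁ P₂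
  have hI1 : (P₁ ∩ P₂).card ≤ 1 := by
    by_contra hlt
    push Not at hlt
    have hsub : P₁ ∩ P₂ ⊆ P₁ := Finset.inter_subset_left
    have heq : P₁ ∩ P₂ = P₁ := Finset.eq_of_subset_of_card_le hsub (by omega)
    have h12 : P₁ ⊆ P₂ := by rw [← heq]; exact Finset.inter_subset_right
    exact hPne (Finset.eq_of_subset_of_card_le h12 (by omega))
  have hIcard : (P₁ ∩ P₂).card = 1 := by omega
  obtain ⟨w, hw⟩ := Finset.card_eq_one.1 hIcard
  have hUT : P₁ ∪ P₂ = nonColoops M S :=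
    Finset.eq_of_subset_of_card_le (Finset.union_subset hP1T hP2T) (by omega)
  -- B₁ ∪ B₂ = S ∖ {w} has rank 5; B₁ ∩ B₂ = coloops S
  have hwP : w ∈ P₁ := Finset.inter_subset_left (hw ▸ Finset.mem_singleton_self w)
  have hrw : rkN M (S.erase w) = 4 + 1 := by
    rw [hPxy, Finset.mem_insert, Finset.mem_singleton] at hwP
    rcases hwP with rfl | rfl
    · exact hser.2.2.2.1
    · exact hser.2.2.2.2.1
  have hBU : B₁ ∪ B₂ = S.erase w := by
    rw [hB1eq, hB2eq, ← Finset.sdiff_inter_distrib_right, hw, Finset.sdiff_singleton_eq_erase]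
  have hBI : B₁ ∩ B₂ = coloops M S := by
    rw [hB1eq, hB2eq, ← Finset.sdiff_union_distrib, hUT]
    unfold nonColoops
    exact Finset.sdiff_sdiff_eq_self (coloops_subset_self S)
  -- G ⊆ S
  have hGS : G ⊆ S := by
    intro g hg
    by_contra hgS
    have hg1 : g ∈ clF M B₁ := by
      by_contra h
      have : g ∈ S \ B₁ := by rw [sdiff_eq_of_mem_ex2 h1 hm1]; exact Finset.mem_sdiff.2 ⟨hg, h⟩
      exact hgS (Finset.mem_sdiff.1 this).1
    have hg2 : g ∈ clF M B₂ := by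
      by_contra h
      have : g ∈ S \ B₂ := by rw [sdiff_eq_of_mem_ex2 h2 hm2]; exact Finset.mem_sdiff.2 ⟨hg, h⟩
      exact hgS (Finset.mem_sdiff.1 this).1
    -- K ∪ {g} has rank 4
    have hK : coloops M S = G.filter (fun y => y ∉ clF M (G.erase y)) :=
      coloops_eq_filter_of_card hS (by rw [ha, hk])
    have hKg : rkN M (coloops M S ∪ {g}) = 4 := by
      have h := eRk_union_coloops hGE (coloops M S)
        (fun y hy => by rw [hK, Finset.mem_filter] at hy; exact hy) (X := {g})
        (Finset.singleton_subset_iff.2 hg)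
        (Finset.disjoint_singleton_right.2 (fun h => hgS (coloops_subset_self S h)))
      have hg1' : M.eRk (({g} : Finset α) : Set α) = 1 := by
        rw [Finset.coe_singleton, (hl g (hGE hg)).eRk_eq_encard, Set.encard_singleton]
      rw [ha, hg1', eRk_eq_rkN] at h
      have h' : rkN M (coloops M S ∪ {g}) = 3 + 1 := by exact_mod_cast h
      omega
    -- B_i ⊆ cl (K ∪ {g})
    have hKsub : ∀ B ∈ ({B₁, B₂} : Finset (Finset α)), coloops M S ⊆ B := by
      intro B hB
      rw [Finset.mem_insert, Finset.mem_singleton] at hB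
      rcases hB with rfl | rfl
      · rw [← hBI]; exact Finset.inter_subset_left
      · rw [← hBI]; exact Finset.inter_subset_right
    have hcl : ∀ B, B ∈ Uq M (4 + 2) 4 → coloops M S ⊆ B → g ∈ clF M B →
        (B : Set α) ⊆ M.closure ((coloops M S ∪ {g} : Finset α) : Set α) := by
      intro B hBU hKB hgB
      have hBE : B ⊆ gr M := (mem_Uq.1 hBU).1
      have hX : B ∪ (coloops M S ∪ {g}) ⊆ gr M :=
        Finset.union_subset hBE (Finset.union_subset (hKB.trans hBE) (Finset.singleton_subset_iff.2 (hGE hg)))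
      have hXcl : B ∪ (coloops M S ∪ {g}) ⊆ clF M B := by
        apply Finset.union_subset (subset_clF_of_subset_gr hBE)
        apply Finset.union_subset (hKB.trans (subset_clF_of_subset_gr hBE))
        exact Finset.singleton_subset_iff.2 hgB
      have hr : rkN M (coloops M S ∪ {g}) = rkN M (B ∪ (coloops M S ∪ {g})) := by
        apply le_antisymm (rkN_mono Finset.subset_union_right)
        rw [hKg]
        exact rkN_le_of_subset_clF hBU hXcl
      exact (Finset.coe_subset.2 Finset.subset_union_left).trans
        (subset_closure_of_rkN_eq hX Finset.subset_union_right hr)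
    have hsub : ((B₁ ∪ B₂ : Finset α) : Set α) ⊆ M.closure ((coloops M S ∪ {g} : Finset α) : Set α) := by
      rw [Finset.coe_union]
      exact Set.union_subset (hcl B₁ hB1U (hKsub B₁ (by simp)) hg1) (hcl B₂ hB2U (hKsub B₂ (by simp)) hg2)
    have hle : M.eRk ((B₁ ∪ B₂ : Finset α) : Set α) ≤ M.eRk ((coloops M S ∪ {g} : Finset α) : Set α) := by
      calc M.eRk ((B₁ ∪ B₂ : Finset α) : Set α)
          ≤ M.eRk (M.closure ((coloops M S ∪ {g} : Finset α) : Set α)) := M.eRk_mono hsub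
        _ = _ := M.eRk_closure_eq _
    rw [hBU, eRk_eq_rkN, eRk_eq_rkN, hrw, hKg] at hle
    have : (4 + 1 : ℕ) ≤ 4 := by exact_mod_cast hle
    omega
  have hGeq : G = S := Finset.Subset.antisymm hGS hSG
  -- the layer-0 covering preimage B₀ = G ∖ y has a complement of rank ≤ 5
  unfold k1 at hk1
  obtain ⟨B₀, hB₀⟩ := Finset.card_pos.1 hk1
  rw [Finset.mem_filter, mem_coverPreimages] at hB₀
  obtain ⟨⟨hB₀m, hcov⟩, -⟩ := hB₀
  obtain ⟨y, hy, hyS⟩ := mem_coverSets.1 hcov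
  have hB₀U : B₀ ∈ Uq M (4 + 2) 4 := (mem_membersIn.1 hB₀m).1
  have hyB : y ∉ B₀ := notMem_of_notMem_clF hB₀U (Finset.mem_sdiff.1 hy).2
  have hB₀eq : B₀ = G.erase y := by rw [hGeq, ← hyS, Finset.erase_insert hyB]
  have hcompl : gr M \ B₀ ⊆ insert y (gr M \ G) := by
    intro e he
    rw [Finset.mem_sdiff, hB₀eq, Finset.mem_erase] at he
    rw [Finset.mem_insert, Finset.mem_sdiff]
    by_cases hey : e = y
    · exact Or.inl hey
    · exact Or.inr ⟨he.1, fun heG => he.2 ⟨hey, heG⟩⟩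
  have hcard : (gr M \ B₀).card ≤ 5 := by
    calc (gr M \ B₀).card ≤ (insert y (gr M \ G)).card := Finset.card_le_card hcompl
      _ ≤ (gr M \ G).card + 1 := Finset.card_insert_le _ _
      _ = 5 := by rw [hd]
  have hr6 : M.eRk ((gr M \ B₀ : Finset α) : Set α) = ((4 + 2 : ℕ) : ℕ∞) := (mem_Uq.1 hB₀U).2.2
  have hle : M.eRk ((gr M \ B₀ : Finset α) : Set α) ≤ ((gr M \ B₀).card : ℕ∞) := by
    rw [← Set.encard_coe_eq_coe_finsetCard]
    exact M.eRk_le_encard _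
  rw [hr6] at hle
  have : (4 + 2 : ℕ) ≤ (gr M \ B₀).card := by exact_mod_cast hle
  omega

end Three

end PercRepro.Shadow
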